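import Summits.Parity.GeneralizedHardyLittlewood.Theses.ParityWeightedChenSwitching
import HarnessLib

/-!
# Route `ParityWeightedChenSwitching` — the `Assembly` item (stmt-Parity-18668)

`Assembly : MoebiusShiftedPrimesLevel → MoebiusSwitchedHostLevel → ParityChenInequality →
TwinLowerDensityToGHL → GeneralizedHardyLittlewood` is, hypothesis for hypothesis, the route's own
deciding theorem `…Theses.ParityWeightedChenSwitching.closes` (the gate-checked glue: from
`S1 : π₂(x) ≥ c·x/log²x − C·(E₁(x) + E₂(x))` eventually and `K1, K2 : E₁, E₂ = o(x/log²x)` one gets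
`π₂(x) ≥ (c/2)·x/log²x` for large `x`, i.e. `TwinLowerDensity`, and the residual `R` carries it to the
sub-problem statement).  This file closes the item by currying that theorem.

Honesty label: pure glue.  Of the four hypotheses, `ParityChenInequality` (S1) is PROVED
(`…Theorems.parityChenInequality_proof`, p543554); `MoebiusShiftedPrimesLevel` (K1),
`MoebiusSwitchedHostLevel` (K2) and `TwinLowerDensityToGHL` (R) are OPEN PROBLEMS (K1 ⊇ the folklore
conjecture "μ ⟂ shifted primes", `Literature.NumberTheory.Sieve.MoebiusShiftedPrimesConjecture` at
`h = 2`, by `…Theorems.MoebiusShiftedPrimesLevel.Negative.moebiusShiftedPrimesConjecture_two_of_moebiusShiftedPrimesLevel`).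
Nothing here is distance to twin primes or to GHL.
-/

namespace Summit.Parity.GeneralizedHardyLittlewood.Theorems

/-- **`Assembly` PROVED** (item stmt-Parity-18668 of route `ParityWeightedChenSwitching`):
`K1 → K2 → S1 → R → GeneralizedHardyLittlewood`, obtained by currying the route's deciding theorem
`Summit.Parity.GeneralizedHardyLittlewood.Theses.ParityWeightedChenSwitching.closes`
(K1, K2, S1 give positive lower Hardy–Littlewood density of twin primes with constant `c/2`; R maps
that to the sub-problem statement).  Pure glue; no mathematical content beyond the deciding theorem. -/
theorem parityWeightedChenSwitching_assembly_proof :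
    Summit.Parity.GeneralizedHardyLittlewood.Theses.ParityWeightedChenSwitching.Assembly := by
  unfold Summit.Parity.GeneralizedHardyLittlewood.Theses.ParityWeightedChenSwitching.Assembly
  intro h₁ h₂ h₃ h₄
  exact Summit.Parity.GeneralizedHardyLittlewood.Theses.ParityWeightedChenSwitching.closes h₁ h₂ h₃ h₄

end Summit.Parity.GeneralizedHardyLittlewood.Theorems
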